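import Literature.NumberTheory.Automorphic.ArchRankinSelbergOfTorusKirillov
import HarnessLib

/-!
# Jacquet–Shalika's archimedean convergence theorem in ranks `n ≤ 1` (end-to-end check of the
# torus-Kirillov reduction)

Topic `NumberTheory/Automorphic`; namespace `Literature.NumberTheory.Automorphic`. Proof file
(theorems only). The named fact `JacquetShalika1990_archRankinSelbergLIntegral_lt_top n K`
(`ArchRankinSelbergAbsConvergence`: finiteness of `Ψ_∞(1; W, W̄, Φ^{Gauss})` for every irreducible
unitary `τ` of `GL_n(K_∞)`, every continuous Whittaker functional and every Gårding vector) is reduced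
in `ArchRankinSelbergOfTorusKirillov` to the torus Kirillov bound on `GL_{n-1} ↪ GL_n`. This file
PROVES the fact in the degenerate ranks, where no Kirillov theory is needed:

* `JacquetShalika1990_archRankinSelbergLIntegral_lt_top_one` — **rank `1`**: the torus of `GL_0` is a
  point, so the torus Kirillov bound is the continuity estimate `|ℓ(v)|² ≤ C Σ_w ‖τ(w) v‖²` of the
  functional (Cauchy–Schwarz), and the reduction applies (`K_∞ˣ` acts through a unitary character,
  the Gaussian moment `∫ e^{-a‖c‖²} ‖c‖ d^×c` is finite);
* `JacquetShalika1990_archRankinSelbergLIntegral_lt_top_zero` — **rank `0`**: `GL_0` is trivial and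
  the integral is a constant times the (finite) mass of the Haar measures.

As with `ArchWhittakerUniquenessLowRank`, the point is that the whole reduction is exercised
unconditionally in the ranks where its analytic input is available, certifying that its hypotheses
are jointly satisfiable and correctly wired. (Rank `2` is proved in the tree in the global currency of
smoothed cusp forms, `KirillovL2BoundArch`; ranks `≥ 3` are the open analytic input.)

## References

* H. Jacquet, J. A. Shalika, *On Euler products and the classification of automorphic
  representations I*, Amer. J. Math. 103 (1981), 499–558, §4 [JacquetShalikaAJM1981].
* J. W. Cogdell, *Analytic theory of L-functions for GL_n*, in *An Introduction to the Langlands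
  Program* (2004), §3.1 item (1), §3.2 [CogdellAnalyticTheory2004].
-/

noncomputable section

open MeasureTheory Measure NumberField NumberField.mixedEmbedding IsDedekindDomain Set Filter
open scoped MatrixGroups ENNReal NNReal Classical Matrix.Norms.Operator

namespace Literature.NumberTheory.Automorphic

variable {K : Type} [Field K] [NumberField K]

set_option backward.isDefEq.respectTransparency false

/-- **Rank one.** `JacquetShalika1990_archRankinSelbergLIntegral_lt_top 1 K`: the torus Kirillov bound for
`GL_0 ↪ GL_1` is the continuity of the Whittaker functional. [cite: JacquetShalikaAJM1981, §4]
[cite: CogdellAnalyticTheory2004, §3.1 item (1) and §3.2] -/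
theorem JacquetShalika1990_archRankinSelbergLIntegral_lt_top_one :
    JacquetShalika1990_archRankinSelbergLIntegral_lt_top 1 K := by
  refine JacquetShalika1990_archRankinSelbergLIntegral_lt_top_succ_of_torusKirillovBound (n := 0)
    fun hcpt E _ _ _ τ hτ hτu hτi ℓ hℓ _ _ => ?_
  obtain ⟨C, 𝒮, hC0, hC⟩ := hℓ.norm_le
  haveI : BorelSpace (Fin 0 → (mixedSpace K)ˣ) := Pi.borelSpace
  set μA' : Measure (Fin 0 → (mixedSpace K)ˣ) := Measure.haar with hμA'
  haveI : IsFiniteMeasure μA' := inferInstance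
  refine ⟨μA', inferInstance, μA' Set.univ * ENNReal.ofReal (C ^ 2 * 𝒮.card), ?_, 𝒮, fun v => ?_⟩
  · exact ENNReal.mul_ne_top (measure_ne_top _ _) ENNReal.ofReal_ne_top
  -- the integrand is constant: `diag() = 1`, the weight is an empty product
  have hdiag : glDiagonal (0 + 1) (mixedSpace K) (Fin.snoc (α := fun _ => (mixedSpace K)ˣ)
      (fun i : Fin 0 => i.elim0) 1) = 1 := by
    refine Units.ext (Matrix.ext fun i j => ?_)
    rw [coe_glDiagonal, Units.val_one]
    have hi : i = Fin.last 0 := Fin.ext (by have := i.isLt; rw [Fin.val_last]; omega)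
    have hj : j = Fin.last 0 := Fin.ext (by have := j.isLt; rw [Fin.val_last]; omega)
    subst hi; subst hj
    rw [Matrix.diagonal_apply_eq, Matrix.one_apply_eq, Fin.snoc_last, Units.val_one]
  have hconst : ∀ y' : Fin 0 → (mixedSpace K)ˣ,
      ‖ℓ ⟨τ (toArch hcpt (glDiagonal (0 + 1) (mixedSpace K) (Fin.snoc (α := fun _ => (mixedSpace K)ˣ) y' 1)))
          (v : E), apply_mem_archGardingSpace hτ _ v.2⟩‖ₑ ^ 2 * ENNReal.ofReal (archTorusWeight 0 K 0 y') =
        ‖ℓ v‖ₑ ^ 2 := by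
    intro y'
    have hy : y' = fun i : Fin 0 => i.elim0 := funext fun i => i.elim0
    subst hy
    have hw : archTorusWeight 0 K 0 (fun i : Fin 0 => i.elim0) = 1 := by
      unfold archTorusWeight
      exact Finset.prod_of_isEmpty _
    rw [hw, ENNReal.ofReal_one, mul_one]
    have hvec : (⟨τ (toArch hcpt (glDiagonal (0 + 1) (mixedSpace K) (Fin.snoc (α := fun _ => (mixedSpace K)ˣ)
        (fun i : Fin 0 => i.elim0) 1))) (v : E), apply_mem_archGardingSpace hτ _ v.2⟩ : archGardingSpace hcpt τ) = v := by
      refine Subtype.ext ?_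
      change τ (toArch hcpt (glDiagonal (0 + 1) (mixedSpace K) (Fin.snoc (α := fun _ => (mixedSpace K)ˣ)
        (fun i : Fin 0 => i.elim0) 1))) (v : E) = v
      rw [hdiag]
      change τ 1 (v : E) = v
      rw [map_one]
      rfl
    rw [hvec]
  -- Cauchy–Schwarz: `|ℓ v|² ≤ C² |𝒮| Σ ‖τ(w) v‖²`
  have hCS : ‖ℓ v‖ ^ 2 ≤ C ^ 2 * 𝒮.card * ∑ w ∈ 𝒮, ‖archWordDerivE hcpt τ w (v : E)‖ ^ 2 := by
    have h1 : ‖ℓ v‖ ^ 2 ≤ (C * ∑ w ∈ 𝒮, ‖archWordDerivE hcpt τ w (v : E)‖) ^ 2 :=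
      pow_le_pow_left₀ (norm_nonneg _) (hC v) 2
    have h2 : (∑ w ∈ 𝒮, ‖archWordDerivE hcpt τ w (v : E)‖) ^ 2 ≤
        𝒮.card * ∑ w ∈ 𝒮, ‖archWordDerivE hcpt τ w (v : E)‖ ^ 2 := sq_sum_le_card_mul_sum_sq
    calc ‖ℓ v‖ ^ 2 ≤ (C * ∑ w ∈ 𝒮, ‖archWordDerivE hcpt τ w (v : E)‖) ^ 2 := h1
      _ = C ^ 2 * (∑ w ∈ 𝒮, ‖archWordDerivE hcpt τ w (v : E)‖) ^ 2 := by ring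
      _ ≤ C ^ 2 * (𝒮.card * ∑ w ∈ 𝒮, ‖archWordDerivE hcpt τ w (v : E)‖ ^ 2) :=
          mul_le_mul_of_nonneg_left h2 (sq_nonneg C)
      _ = _ := by ring
  rw [lintegral_congr fun y' => hconst y', lintegral_const, sum_enorm_sq_eq_ofReal, mul_comm (‖ℓ v‖ₑ ^ 2),
    mul_assoc, ← ENNReal.ofReal_mul (by positivity)]
  refine mul_le_mul' le_rfl ?_
  rw [← ofReal_norm, ← ENNReal.ofReal_pow (norm_nonneg _)]
  exact ENNReal.ofReal_le_ofReal hCS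

/-- **Rank zero.** `JacquetShalika1990_archRankinSelbergLIntegral_lt_top 0 K`: `GL_0(K_∞)` is trivial, so
the integrand is constant and the Haar measures are finite. [folklore] -/
theorem JacquetShalika1990_archRankinSelbergLIntegral_lt_top_zero :
    JacquetShalika1990_archRankinSelbergLIntegral_lt_top 0 K := by
  intro hcpt E _ _ _ τ hτ hτu hτi ℓ hℓ e _ _ _ _ μA hμA μK hμK
  haveI := hμA; haveI := hμK
  haveI : CompactSpace ↥(Kinf 0 K) := isCompact_iff_compactSpace.1 (isCompact_Kinf_holds 0 K)
  haveI : IsFiniteMeasure μK := inferInstance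
  haveI : BorelSpace (Fin 0 → (mixedSpace K)ˣ) := Pi.borelSpace
  haveI : IsFiniteMeasure μA := inferInstance
  rw [archRankinSelbergLIntegral_def]
  set p₀ : (Fin 0 → (mixedSpace K)ˣ) × ↥(Kinf 0 K) := (fun i => i.elim0, 1) with hp₀
  haveI : Subsingleton ((Fin 0 → (mixedSpace K)ˣ) × ↥(Kinf 0 K)) := by
    haveI : Subsingleton (GL (Fin 0) (mixedSpace K)) := by
      refine ⟨fun a b => Units.ext (Matrix.ext fun i _ => i.elim0)⟩
    infer_instance
  set c : ℝ≥0∞ := ‖ℓ ⟨τ (toArch hcpt (glDiagonal 0 (mixedSpace K) p₀.1 * (p₀.2 : GL (Fin 0) (mixedSpace K)))) (e : E),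
      apply_mem_archGardingSpace hτ _ e.2⟩‖ₑ ^ 2 *
    ENNReal.ofReal (gaussArchTestFun 0 K (archLastRow 0 K (glDiagonal 0 (mixedSpace K) p₀.1 *
      (p₀.2 : GL (Fin 0) (mixedSpace K)))) * archTorusWeight 0 K 1 p₀.1) with hc
  have hcfin : c ≠ ⊤ := ENNReal.mul_ne_top (ENNReal.pow_ne_top enorm_ne_top) ENNReal.ofReal_ne_top
  calc _ = ∫⁻ _p, c ∂(μA.prod μK) := lintegral_congr fun p => by rw [Subsingleton.elim p p₀]
    _ = c * (μA.prod μK) Set.univ := lintegral_const c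
    _ < ⊤ := ENNReal.mul_lt_top hcfin.lt_top (measure_lt_top _ _)

end Literature.NumberTheory.Automorphic
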